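import Summits.CriticalPhenomena.PercolationContinuityZ3.Theorems.Transplant.FKConnectivityAllQForestHubPairDecomposition
import HarnessLib

/-!
# The NODE–SCP DUALITY identity for the square-free adjacent forest Rayleigh margin:  `margin + S₂ = 2·E⁰`
# (the node is an UPPER bound on the class-preference correlation `S₂`, the new node SCP is its positivity)

Support file (`--supports stmt-CriticalPhenomena-4575`), FK sub-lane `prim-bschramm-fk-1` (gen 25) of the post-continuity programme;
builds on p205010 (kernel theorem, internal audit signed; external expert review pending).  One `@[conjecture]`-shaped counting node with its
`Pos` form (NOT asserted), no named facts, no sorries; standard axioms.  Memo bschramm/FROM-fk-1-g25-HUB-PAIR-DECOMPOSITION.md §3.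

SETTING.  A fibre `(N ∪ {e,f}, u₀)` of the node (♣)⁰ = `AdjForestRayleighNoSqOn` with `e = ov`, `f = oy` free (`o, v, y` distinct) and its
"rest" `(N, u₀)` (the multigraph `H = G − e − f`).  In a colouring of the rest (first class `ω ⊇ u₀`, second class `ω ∆ N ⊇ u₀`, both forests)
put `R_v := {o ~ v}`, `R_y := {o ~ y}` (per class) and the CLASS PREFERENCE of a vertex `z` towards the centre `o`:
`δ_z := [z ~ o in the first class] − [z ~ o in the second class] ∈ {−1, 0, 1}`.  Counting fibrewise,
* `PP := #(Fo ∩ R_v ∩ R_y, Fo ∩ R_vᶜ ∩ R_yᶜ)` (v and y prefer the same class), `PM := #(Fo ∩ R_v ∩ R_yᶜ, Fo ∩ R_vᶜ ∩ R_y)` (opposite classes),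
  so that `S₂ := Σ δ_v δ_y = 2(PP − PM)`;
* `E⁰ := #(Fo ∩ {v ~ y} ∩ R_vᶜ, Fo)` (v, y joined in the first class by a path avoiding the cluster of `o`).
Inserting `e` and `f` (`fibreCount_insert_two_both/one` of `…ForestAdjacentGuard` and the forest criteria `isForestCfg_insert_iff`,
`isForestCfg_insert_two_iff`) gives `bad = #(Fo ∩ R_vᶜ ∩ R_yᶜ ∩ {v ≁ y}, Fo) = #(Fo ∩ R_vᶜ ∩ R_yᶜ, Fo) − E⁰` and `good = #(Fo ∩ R_vᶜ, Fo ∩ R_yᶜ)`;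
splitting into the sixteen atoms `n(αβ|γε)` of `(R_v, R_y)` in the two classes and using the involution `n(αβ|γε) = n(γε|αβ)` three times:
* **`adjForestNoSq_good_add_pp_eq`** (THE DUALITY IDENTITY): **`good + PP = bad + PM + E⁰`**, i.e. `margin + S₂ = 2E⁰` with `margin = good − bad`.
Consequently, on every such fibre: the node `bad ≤ good` ⟺ `PP ≤ PM + E⁰` (an UPPER bound on the class-preference correlation), and the
positivity `PM ≤ PP` ⟺ `good ≤ bad + E⁰` (an upper bound on the margin):
* **`adjForestNoSq_fibre_iff_pp_le`**, **`adjForestNoSq_good_le_of_scp`**, **`forest_pp_sandwich`** (`PM ≤ PP ≤ PM + E⁰` under both).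
NEW NODE — SAME-CLASS PREFERENCE `ForestSameClassPrefOn V` (SCP; NOT asserted): `PM ≤ PP` on every fibre, for every centre `o` and vertices
`v, y`; in graph language `E[δ_v δ_y] ≥ 0` — two vertices prefer to be joined to a third in the SAME class of a uniform ordered 2-forest
colouring (`#(v,y ∈ C₁(o)) ≥ #(v ∈ C₁(o), y ∈ C₂(o))`).  By the hub expansion at a degree-2 hub, SCP at `(H; a; v,y)` is EXACTLY the one-class
hub-pair positivity (★) `HubPairOneClassOn` of `…ForestHubPairDecomposition` at the vertex `a` for the hub graph `H + o + {ov, oy}` (memo §2) —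
the first member of the (★) hierarchy.  EVIDENCE (exact, exhaustive; numerics/starcm/scp.c and scp_test.py agree on n ≤ 6): 0 failures over every
connected graph with ≤ 9 vertices, every centre and pair (n = 9: 15,555,456 tests, 7,004,985 tight), over 433,002 random multigraph tests; the
4-point analogue `Σ δ_{z₁}δ_{z₂}δ_{z₃}δ_{z₄} ≥ 0` 0 / 38,888,640 and the product inequality `N·#(v ∈ C₁(o), y ∈ C₂(o)) ≤ #(v ∈ C₁(o))·#(y ∈ C₂(o))`
0 / 31,110,912, while same-class positive CORRELATION `N·#(v,y ∈ C₁(o)) ≥ #(v ∈ C₁(o))·#(y ∈ C₁(o))` is FALSE (66,095 failures at n = 9).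
So (♣)⁰ and SCP are the two sides `0 ≤ S₂ ≤ 2E⁰` of one quantity.
[cite: SempleWelsh2008, Conj. 1.1 (p. 2); Thm. 4.2 (p. 11)] [cite: CibulkaHladkyLaCroixWagner2008, Thm. 1 (p. 2)] [cite: Linusson2011, Prop. 2.6]
[cite: Grimmett2006, §1.5 (p. 13)]
-/

noncomputable section

namespace Summit.CriticalPhenomena.PercolationContinuityZ3.Theorems
namespace FK

open Set Literature.Probability.LatticeModels Literature.Probability.Percolation
open scoped Classical symmDiff

variable {V : Type*} [Fintype V]

/-- **SAME-CLASS PREFERENCE (SCP) on the vertex type `V`**: on every fibre `(N, u₀)` and for all `o, v, y`,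
`#(Fo ∩ {o~v} ∩ {o≁y}, Fo ∩ {o≁v} ∩ {o~y}) ≤ #(Fo ∩ {o~v} ∩ {o~y}, Fo ∩ {o≁v} ∩ {o≁y})` (`PM ≤ PP`: two vertices are joined to a third in the
same class at least as often as in opposite classes, exclusively).  CONJECTURE-SHAPED COUNTING STATEMENT, NOT asserted.
[cite: SempleWelsh2008, Conj. 1.1 (p. 2)] [cite: Linusson2011, Prop. 2.6] -/
def ForestSameClassPrefOn (V : Type*) [Fintype V] : Prop :=
  ∀ (N u₀ : BondConfig V), Disjoint u₀ N → ∀ (o v y : V),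
    fibreCount N u₀ (forestEv V ∩ reachEv o v ∩ (reachEv o y)ᶜ) (forestEv V ∩ (reachEv o v)ᶜ ∩ reachEv o y) ≤
      fibreCount N u₀ (forestEv V ∩ reachEv o v ∩ reachEv o y) (forestEv V ∩ (reachEv o v)ᶜ ∩ (reachEv o y)ᶜ)

/-- **Same-class preference on every finite vertex type.**  CONJECTURE-SHAPED, NOT asserted (evidence in the module docstring).
[cite: SempleWelsh2008, Conj. 1.1 (p. 2); Thm. 4.2 (p. 11)] -/
@[conjecture] def ForestSameClassPrefPos : Prop := ∀ n : ℕ, ForestSameClassPrefOn (Fin n)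

section Duality

variable {N u₀ : BondConfig V} {o v y : V}

/-- `bad` of the fibre `(N ∪ {e,f}, u₀)` counted on the rest: the first class must separate `o, v, y` pairwise.
[cite: CibulkaHladkyLaCroixWagner2008, Thm. 1 (p. 2)] [cite: Linusson2011, Prop. 2.6] -/
theorem adjForestNoSq_bad_eq_rest (hov : o ≠ v) (hoy : o ≠ y) (hvy : v ≠ y) (heN : s(o, v) ∉ N) (hfN : s(o, y) ∉ N)
    (heu : s(o, v) ∉ u₀) (hfu : s(o, y) ∉ u₀) :
    fibreCount (insert s(o, y) (insert s(o, v) N)) u₀ (forestEv V ∩ {ω | s(o, v) ∈ ω ∧ s(o, y) ∈ ω}) (forestEv V) =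
      fibreCount N u₀ (forestEv V ∩ (reachEv o v)ᶜ ∩ (reachEv o y)ᶜ ∩ (reachEv v y)ᶜ) (forestEv V) := by
  rw [fibreCount_insert_two_both heN hfN]
  refine fibreCount_congr_fibre N u₀ fun ω hω => ?_
  have he := notMem_and_notMem_symmDiff_of_fibre heN heu hω
  have hf := notMem_and_notMem_symmDiff_of_fibre hfN hfu hω
  have h2 := ForestSquareCex.isForestCfg_insert_two_iff hov hoy hvy he.1 hf.1
  simp only [mem_inter_iff, mem_setOf_eq, mem_compl_iff, mem_reachEv]
  constructor
  · rintro ⟨⟨-, hF⟩, -, hB⟩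
    have h := h2.1 hF
    exact ⟨⟨⟨⟨h.1, h.2.1⟩, h.2.2.1⟩, h.2.2.2⟩, hB⟩
  · rintro ⟨⟨⟨⟨hF, h1⟩, h3⟩, h4⟩, hB⟩
    exact ⟨⟨⟨he.1, hf.1⟩, h2.2 ⟨hF, h1, h3, h4⟩⟩, ⟨he.2, hf.2⟩, hB⟩

/-- `good` of the fibre `(N ∪ {e,f}, u₀)` counted on the rest: `#(Fo ∩ {o≁v}, Fo ∩ {o≁y})`.
[cite: CibulkaHladkyLaCroixWagner2008, Thm. 1 (p. 2)] [cite: Linusson2011, Prop. 2.6] -/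
theorem adjForestNoSq_good_eq_rest (hov : o ≠ v) (hoy : o ≠ y) (hvy : v ≠ y) (heN : s(o, v) ∉ N) (hfN : s(o, y) ∉ N)
    (heu : s(o, v) ∉ u₀) (hfu : s(o, y) ∉ u₀) :
    fibreCount (insert s(o, y) (insert s(o, v) N)) u₀ (forestEv V ∩ {ω | s(o, v) ∈ ω}) (forestEv V ∩ {ω | s(o, y) ∈ ω}) =
      fibreCount N u₀ (forestEv V ∩ (reachEv o v)ᶜ) (forestEv V ∩ (reachEv o y)ᶜ) := by
  have hef : s(o, v) ≠ s(o, y) := fun h' => hvy (Sym2.congr_right.1 h')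
  rw [fibreCount_insert_two_one hef heN hfN]
  refine fibreCount_congr_fibre N u₀ fun ω hω => ?_
  have he := notMem_and_notMem_symmDiff_of_fibre heN heu hω
  have hf := notMem_and_notMem_symmDiff_of_fibre hfN hfu hω
  have h1 := insert_mem_forestEv_iff hov he.1
  have h2 := insert_mem_forestEv_iff hoy hf.2
  simp only [mem_inter_iff, mem_setOf_eq, mem_compl_iff]
  constructor
  · rintro ⟨⟨-, hF⟩, -, hB⟩
    exact ⟨⟨(h1.1 hF).1, (h1.1 hF).2⟩, (h2.1 hB).1, (h2.1 hB).2⟩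
  · rintro ⟨⟨hF, hr⟩, hB, hs⟩
    exact ⟨⟨⟨he.1, hf.1⟩, h1.2 ⟨hF, hr⟩⟩, ⟨he.2, hf.2⟩, h2.2 ⟨hB, hs⟩⟩

/-- **THE NODE–SCP DUALITY IDENTITY `good + PP = bad + PM + E⁰`** on a fibre with `e = ov`, `f = oy` free (`o, v, y` distinct), all four
side counts taken on the rest `(N, u₀)`:  `margin + S₂ = 2·E⁰`. [cite: SempleWelsh2008, Conj. 1.1 (p. 2)]
[cite: CibulkaHladkyLaCroixWagner2008, Thm. 1 (p. 2)] [cite: Linusson2011, Prop. 2.6] -/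
theorem adjForestNoSq_good_add_pp_eq (hov : o ≠ v) (hoy : o ≠ y) (hvy : v ≠ y) (heN : s(o, v) ∉ N) (hfN : s(o, y) ∉ N)
    (heu : s(o, v) ∉ u₀) (hfu : s(o, y) ∉ u₀) :
    fibreCount (insert s(o, y) (insert s(o, v) N)) u₀ (forestEv V ∩ {ω | s(o, v) ∈ ω}) (forestEv V ∩ {ω | s(o, y) ∈ ω}) +
        fibreCount N u₀ (forestEv V ∩ reachEv o v ∩ reachEv o y) (forestEv V ∩ (reachEv o v)ᶜ ∩ (reachEv o y)ᶜ) =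
      fibreCount (insert s(o, y) (insert s(o, v) N)) u₀ (forestEv V ∩ {ω | s(o, v) ∈ ω ∧ s(o, y) ∈ ω}) (forestEv V) +
        fibreCount N u₀ (forestEv V ∩ reachEv o v ∩ (reachEv o y)ᶜ) (forestEv V ∩ (reachEv o v)ᶜ ∩ reachEv o y) +
        fibreCount N u₀ (forestEv V ∩ reachEv v y ∩ (reachEv o v)ᶜ) (forestEv V) := by
  rw [adjForestNoSq_good_eq_rest hov hoy hvy heN hfN heu hfu, adjForestNoSq_bad_eq_rest hov hoy hvy heN hfN heu hfu]
  set F := forestEv V with hF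
  set Rv := reachEv (V := V) o v with hRv
  set Ry := reachEv (V := V) o y with hRy
  set Rvy := reachEv (V := V) v y with hRvy
  -- atoms of the first slot
  have dj : ∀ (X : Set (BondConfig V)) (R : Set (BondConfig V)), Disjoint (X ∩ Rᶜ) (X ∩ R) :=
    fun X R => Set.disjoint_left.2 fun ω h₁ h₂ => h₁.2 h₂.2
  have cover : ∀ (X : Set (BondConfig V)) (R : Set (BondConfig V)), X = (X ∩ Rᶜ) ∪ (X ∩ R) :=
    fun X R => by rw [← inter_union_distrib_left, compl_union_self, inter_univ]
  -- (1) bad: `F ∩ Rvᶜ ∩ Ryᶜ = (… ∩ Rvyᶜ) ∪ (… ∩ Rvy)` and `F ∩ Rvᶜ ∩ Ryᶜ ∩ Rvy = F ∩ Rvy ∩ Rvᶜ`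
  have hatom : F ∩ Rvᶜ ∩ Ryᶜ ∩ Rvy = F ∩ Rvy ∩ Rvᶜ := by
    ext ω
    simp only [mem_inter_iff, mem_compl_iff, hRv, hRy, hRvy, mem_reachEv]
    constructor
    · rintro ⟨⟨⟨h1, h2⟩, -⟩, h4⟩; exact ⟨⟨h1, h4⟩, h2⟩
    · rintro ⟨⟨h1, h4⟩, h2⟩; exact ⟨⟨⟨h1, h2⟩, fun h3 => h2 (h3.trans h4.symm)⟩, h4⟩
  have hb : fibreCount N u₀ (F ∩ Rvᶜ ∩ Ryᶜ) F =
      fibreCount N u₀ (F ∩ Rvᶜ ∩ Ryᶜ ∩ Rvyᶜ) F + fibreCount N u₀ (F ∩ Rvy ∩ Rvᶜ) F := by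
    rw [← hatom, ← fibreCount_split_left N u₀ F (dj (F ∩ Rvᶜ ∩ Ryᶜ) Rvy), ← cover]
  -- (2) good: split the first slot by `Ry`, then each second slot by `Rv`
  have hg : fibreCount N u₀ (F ∩ Rvᶜ) (F ∩ Ryᶜ) =
      fibreCount N u₀ (F ∩ Rvᶜ ∩ Ryᶜ) (F ∩ Ryᶜ ∩ Rvᶜ) + fibreCount N u₀ (F ∩ Rvᶜ ∩ Ryᶜ) (F ∩ Ryᶜ ∩ Rv) +
        (fibreCount N u₀ (F ∩ Rvᶜ ∩ Ry) (F ∩ Ryᶜ ∩ Rvᶜ) + fibreCount N u₀ (F ∩ Rvᶜ ∩ Ry) (F ∩ Ryᶜ ∩ Rv)) := by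
    rw [← fibreCount_split_right N u₀ _ (dj (F ∩ Ryᶜ) Rv), ← cover, ← fibreCount_split_right N u₀ _ (dj (F ∩ Ryᶜ) Rv), ← cover,
      ← fibreCount_split_left N u₀ _ (dj (F ∩ Rvᶜ) Ry), ← cover]
  -- (3) the unconstrained slot of `bad`'s main term: split by `Rv` then `Ry`
  have hb2 : fibreCount N u₀ (F ∩ Rvᶜ ∩ Ryᶜ) F =
      fibreCount N u₀ (F ∩ Rvᶜ ∩ Ryᶜ) (F ∩ Rvᶜ ∩ Ryᶜ) + fibreCount N u₀ (F ∩ Rvᶜ ∩ Ryᶜ) (F ∩ Rvᶜ ∩ Ry) +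
        (fibreCount N u₀ (F ∩ Rvᶜ ∩ Ryᶜ) (F ∩ Rv ∩ Ryᶜ) + fibreCount N u₀ (F ∩ Rvᶜ ∩ Ryᶜ) (F ∩ Rv ∩ Ry)) := by
    rw [← fibreCount_split_right N u₀ _ (dj (F ∩ Rv) Ry), ← cover, ← fibreCount_split_right N u₀ _ (dj (F ∩ Rvᶜ) Ry), ← cover,
      ← fibreCount_split_right N u₀ _ (dj F Rv), ← cover]
  -- (4) three involutions and two re-bracketings of intersections
  have sw1 : fibreCount N u₀ (F ∩ Rvᶜ ∩ Ry) (F ∩ Ryᶜ ∩ Rvᶜ) = fibreCount N u₀ (F ∩ Rvᶜ ∩ Ryᶜ) (F ∩ Rvᶜ ∩ Ry) := by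
    rw [fibreCount_swap, inter_right_comm F Ryᶜ Rvᶜ]
  have sw2 : fibreCount N u₀ (F ∩ Rvᶜ ∩ Ry) (F ∩ Ryᶜ ∩ Rv) = fibreCount N u₀ (F ∩ Rv ∩ Ryᶜ) (F ∩ Rvᶜ ∩ Ry) := by
    rw [fibreCount_swap, inter_right_comm F Ryᶜ Rv]
  have sw3 : fibreCount N u₀ (F ∩ Rv ∩ Ry) (F ∩ Rvᶜ ∩ Ryᶜ) = fibreCount N u₀ (F ∩ Rvᶜ ∩ Ryᶜ) (F ∩ Rv ∩ Ry) := by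
    rw [fibreCount_swap]
  have rb1 : F ∩ Ryᶜ ∩ Rvᶜ = F ∩ Rvᶜ ∩ Ryᶜ := inter_right_comm F Ryᶜ Rvᶜ
  have rb2 : F ∩ Ryᶜ ∩ Rv = F ∩ Rv ∩ Ryᶜ := inter_right_comm F Ryᶜ Rv
  rw [rb1, rb2] at hg
  rw [rb1] at sw1
  rw [rb2] at sw2
  rw [hg]
  omega

/-- **The node on a fibre with `e, f` free ⟺ `PP ≤ PM + E⁰`** (an upper bound on the class-preference correlation).
[cite: SempleWelsh2008, Conj. 1.1 (p. 2)] [cite: Linusson2011, Prop. 2.6] -/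
theorem adjForestNoSq_fibre_iff_pp_le (hov : o ≠ v) (hoy : o ≠ y) (hvy : v ≠ y) (heN : s(o, v) ∉ N) (hfN : s(o, y) ∉ N)
    (heu : s(o, v) ∉ u₀) (hfu : s(o, y) ∉ u₀) :
    fibreCount (insert s(o, y) (insert s(o, v) N)) u₀ (forestEv V ∩ {ω | s(o, v) ∈ ω ∧ s(o, y) ∈ ω}) (forestEv V) ≤
        fibreCount (insert s(o, y) (insert s(o, v) N)) u₀ (forestEv V ∩ {ω | s(o, v) ∈ ω}) (forestEv V ∩ {ω | s(o, y) ∈ ω}) ↔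
      fibreCount N u₀ (forestEv V ∩ reachEv o v ∩ reachEv o y) (forestEv V ∩ (reachEv o v)ᶜ ∩ (reachEv o y)ᶜ) ≤
        fibreCount N u₀ (forestEv V ∩ reachEv o v ∩ (reachEv o y)ᶜ) (forestEv V ∩ (reachEv o v)ᶜ ∩ reachEv o y) +
          fibreCount N u₀ (forestEv V ∩ reachEv v y ∩ (reachEv o v)ᶜ) (forestEv V) := by
  have h := adjForestNoSq_good_add_pp_eq hov hoy hvy heN hfN heu hfu
  omega

/-- **SCP bounds the margin from above**: `PM ≤ PP` on the rest gives `good ≤ bad + E⁰` on the fibre.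
[cite: SempleWelsh2008, Conj. 1.1 (p. 2)] [cite: Linusson2011, Prop. 2.6] -/
theorem adjForestNoSq_good_le_of_scp (hov : o ≠ v) (hoy : o ≠ y) (hvy : v ≠ y) (heN : s(o, v) ∉ N) (hfN : s(o, y) ∉ N)
    (heu : s(o, v) ∉ u₀) (hfu : s(o, y) ∉ u₀)
    (hscp : fibreCount N u₀ (forestEv V ∩ reachEv o v ∩ (reachEv o y)ᶜ) (forestEv V ∩ (reachEv o v)ᶜ ∩ reachEv o y) ≤
      fibreCount N u₀ (forestEv V ∩ reachEv o v ∩ reachEv o y) (forestEv V ∩ (reachEv o v)ᶜ ∩ (reachEv o y)ᶜ)) :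
    fibreCount (insert s(o, y) (insert s(o, v) N)) u₀ (forestEv V ∩ {ω | s(o, v) ∈ ω}) (forestEv V ∩ {ω | s(o, y) ∈ ω}) ≤
      fibreCount (insert s(o, y) (insert s(o, v) N)) u₀ (forestEv V ∩ {ω | s(o, v) ∈ ω ∧ s(o, y) ∈ ω}) (forestEv V) +
        fibreCount N u₀ (forestEv V ∩ reachEv v y ∩ (reachEv o v)ᶜ) (forestEv V) := by
  have h := adjForestNoSq_good_add_pp_eq hov hoy hvy heN hfN heu hfu
  omega

/-- **The sandwich `PM ≤ PP ≤ PM + E⁰`** on the rest of a fibre, from SCP (lower) and the node (upper).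
[cite: SempleWelsh2008, Conj. 1.1 (p. 2)] [cite: Linusson2011, Prop. 2.6] -/
theorem forest_pp_sandwich (hnode : AdjForestRayleighNoSqOn V) (hscp : ForestSameClassPrefOn V) (hd : Disjoint u₀ N)
    (hov : o ≠ v) (hoy : o ≠ y) (hvy : v ≠ y) (heN : s(o, v) ∉ N) (hfN : s(o, y) ∉ N) (heu : s(o, v) ∉ u₀) (hfu : s(o, y) ∉ u₀) :
    fibreCount N u₀ (forestEv V ∩ reachEv o v ∩ (reachEv o y)ᶜ) (forestEv V ∩ (reachEv o v)ᶜ ∩ reachEv o y) ≤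
        fibreCount N u₀ (forestEv V ∩ reachEv o v ∩ reachEv o y) (forestEv V ∩ (reachEv o v)ᶜ ∩ (reachEv o y)ᶜ) ∧
      fibreCount N u₀ (forestEv V ∩ reachEv o v ∩ reachEv o y) (forestEv V ∩ (reachEv o v)ᶜ ∩ (reachEv o y)ᶜ) ≤
        fibreCount N u₀ (forestEv V ∩ reachEv o v ∩ (reachEv o y)ᶜ) (forestEv V ∩ (reachEv o v)ᶜ ∩ reachEv o y) +
          fibreCount N u₀ (forestEv V ∩ reachEv v y ∩ (reachEv o v)ᶜ) (forestEv V) := by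
  refine ⟨hscp N u₀ hd o v y, (adjForestNoSq_fibre_iff_pp_le hov hoy hvy heN hfN heu hfu).1 ?_⟩
  have hd' : Disjoint u₀ (insert s(o, y) (insert s(o, v) N)) :=
    Set.disjoint_insert_right.2 ⟨hfu, Set.disjoint_insert_right.2 ⟨heu, hd⟩⟩
  exact hnode _ u₀ hd' o v y hvy

end Duality

end FK
end Summit.CriticalPhenomena.PercolationContinuityZ3.Theorems

end
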